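import Literature.NumberTheory.EllipticCurves.Gamma0EisensteinWeightOne
import Mathlib.NumberTheory.LSeries.DirichletContinuation
import HarnessLib

/-!
# The weight-one Eisenstein sum over ALL pairs `(c, d)`, `M ∣ c`, and its factorisation
# `G(z, s) = L(χ, 1 + 2s) · E₁,χ(z, s)` (sorting by the gcd)

Topic `Literature/NumberTheory/EllipticCurves`; namespace
`Literature.NumberTheory.EllipticCurves.ModularForms`. Definitions with bodies (`gTerm`,
`eisensteinOneAll`) and theorems; no named fact.

Hecke's convergence trick (`EisensteinWeightOneRowContinuation.lean`) continues the ROWS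
`∑_{d ∈ ℤ} χ(d)(cz+d)⁻¹|cz+d|^{-2s}` of the series over ALL pairs

  `G(z, s) = ∑_{(c,d) ∈ ℤ², M ∣ c} χ(d) (cz + d)⁻¹ (Im z/|cz + d|²)ˢ`       (`eisensteinOneAll`)

(the pair `(0, 0)` contributes `0`), not of the series `E₁,χ(z, s)` over coprime pairs
(`eisensteinOne`, `Gamma0EisensteinWeightOne.lean`), whose rows are not sums over arithmetic
progressions. The two differ by a Dirichlet `L`-factor: sorting the pairs `v = r • w` by their gcd
`r ≥ 1` (`w` coprime) and using `χ(r w₂) = χ(r) χ(w₂)`, `(r w)(z) = r · w(z)`, and the fact that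
`χ(r) ≠ 0` forces `(r, M) = 1`, so that `M ∣ r w₁ ↔ M ∣ w₁`,

  **`G(z, s) = L(χ, 1 + 2s) · E₁,χ(z, s)`  for `Re s > 1/2`**
  (`eisensteinOneAll_eq_LFunction_mul`)

(Hecke 1927, §1; Miyake, *Modular Forms*, §7.2, the "non-primitive" Eisenstein series
`E_k(z, s; χ, ψ)` of (7.2.1) versus the sum over coprime pairs; the level-one, weight-zero analogue
is `Literature.NumberTheory.Automorphic.tsum_esTerm_eq_zeta_mul`). Ingredients, all proved:

* `e1Term_nsmul` — `e_{r•w}(z, s) = χ(r) r^{-1-2s} e_w(z, s)` for `r ≥ 1`;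
* `gTerm_nsmul` — the same for the `M ∣ c`-restricted summand `gTerm = 𝟙[M ∣ v₁] · e1Term`;
* `summable_gTerm` — absolute convergence over `ℤ² ∖ 0` for `Re s > 1/2`;
* `tsum_gTerm_gammaSet_one_eq` — over coprime pairs `gTerm` sums to `E₁,χ(z, s)`;
* the gcd sorting through Mathlib's `EisensteinSeries.gammaSetDivGcdSigmaEquiv`,
  `gammaSetDivGcdEquiv`, and `DirichletCharacter.LFunction_eq_LSeries`.

## References

* E. Hecke, *Theorie der Eisensteinschen Reihen höherer Stufe…*, Abh. Math. Sem. Hamburg 5 (1927).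
* T. Miyake, *Modular Forms*, Springer (1989), §7.1–7.2.
-/

noncomputable section

open Complex UpperHalfPlane EisensteinSeries Filter
open scoped MatrixGroups Topology Real

namespace Literature.NumberTheory.EllipticCurves.ModularForms

variable {M : ℕ} (χ : DirichletCharacter ℂ M)

/-! ### The summand over all pairs -/

/-- The all-pairs summand `𝟙[M ∣ c] · χ(d) (cz+d)⁻¹ (Im z/|cz+d|²)ˢ` for `v = (c, d) ∈ ℤ²` (it
vanishes at `v = 0`, where `(cz + d)⁻¹ = 0⁻¹ = 0`). [folklore] -/
def gTerm (s : ℂ) (v : Fin 2 → ℤ) (z : ℍ) : ℂ :=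
  if (M : ℤ) ∣ v 0 then e1Term χ s v z else 0

/-- **The weight-one Eisenstein sum over all pairs**
`G(z, s) = ∑_{(c,d) ∈ ℤ², M ∣ c} χ(d) (cz+d)⁻¹ (Im z/|cz+d|²)ˢ` (absolutely convergent for
`Re s > 1/2`; a `tsum` over `ℤ²`). [folklore] -/
def eisensteinOneAll (z : ℍ) (s : ℂ) : ℂ := ∑' v : Fin 2 → ℤ, gTerm χ s v z

/-- `cz + d ≠ 0` for `(c, d) ≠ 0` (a private copy of
`Literature.NumberTheory.Automorphic.linear_ne_zero_of_ne_zero`, whose module imports all of Mathlib;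
pending a librarian hoist of that wrapper to a shared light-weight file). [folklore] -/
private theorem linear_ne_zero_of_ne_zero {v : Fin 2 → ℤ} (hv : v ≠ 0) (z : ℍ) :
    (v 0 : ℂ) * z + v 1 ≠ 0 := by
  have hne : (fun i => (v i : ℝ)) ≠ 0 := by
    intro h; apply hv; ext i
    have := congrFun h i
    simpa using this
  simpa using UpperHalfPlane.linear_ne_zero z hne

/-- The summand vanishes at `v = 0`. [folklore] -/
theorem e1Term_zero_vec (s : ℂ) (z : ℍ) : e1Term χ s 0 z = 0 := by
  simp [e1Term]

/-! ### Scaling by a positive integer -/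

/-- For `r > 0`: `((r^{-2} : ℝ))ˢ = r^{-2s}` as complex powers. [folklore] -/
theorem ofReal_inv_sq_cpow {r : ℕ} (hr : 0 < r) (s : ℂ) :
    ((((r : ℝ) ^ 2)⁻¹ : ℝ) : ℂ) ^ s = (r : ℂ) ^ (-2 * s) := by
  have hr' : (0 : ℝ) < r := by exact_mod_cast hr
  have hr0 : (r : ℂ) ≠ 0 := by exact_mod_cast hr.ne'
  have him : (log (r : ℂ)).im = 0 := by
    rw [← Complex.natCast_log]; exact Complex.ofReal_im _
  have hlog : (log (r : ℂ) * (-2)).im = 0 := by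
    simp [Complex.mul_im, him]
  rw [cpow_mul s (by rw [hlog]; exact neg_lt_zero.mpr Real.pi_pos)
      (by rw [hlog]; exact Real.pi_pos.le),
    cpow_neg, show ((2 : ℂ)) = ((2 : ℕ) : ℂ) by norm_num, cpow_natCast]
  push_cast
  ring_nf

/-- `e1Base (r • w) z = e1Base w z / r²` (`r ≠ 0`). [folklore] -/
theorem e1Base_nsmul {r : ℕ} (hr : 0 < r) (w : Fin 2 → ℤ) (z : ℍ) :
    e1Base (r • w) z = ((r : ℝ) ^ 2)⁻¹ * e1Base w z := by
  have h0 : (r • w) 0 = (r : ℤ) * w 0 := by simp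
  have h1 : (r • w) 1 = (r : ℤ) * w 1 := by simp
  unfold e1Base
  rw [h0, h1]
  push_cast
  rw [show ((r : ℂ) * (w 0 : ℂ)) * (z : ℂ) + (r : ℂ) * (w 1 : ℂ) =
      (r : ℂ) * ((w 0 : ℂ) * z + w 1) by ring, norm_mul, Complex.norm_natCast, mul_pow]
  have hr' : (0 : ℝ) < r := by exact_mod_cast hr
  rcases eq_or_ne ‖(w 0 : ℂ) * z + w 1‖ 0 with h | h
  · rw [h]; simp
  · field_simp

/-- **Scaling**: `e_{r•w}(z, s) = χ(r) r^{-1-2s} e_w(z, s)` for `r ≥ 1` and every `w ∈ ℤ²`.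
[folklore] -/
theorem e1Term_nsmul {r : ℕ} (hr : 0 < r) (s : ℂ) (w : Fin 2 → ℤ) (z : ℍ) :
    e1Term χ s (r • w) z = χ r * (r : ℂ) ^ (-1 - 2 * s) * e1Term χ s w z := by
  rcases eq_or_ne w 0 with rfl | hw
  · simp [e1Term_zero_vec]
  have hr0 : (r : ℂ) ≠ 0 := by exact_mod_cast hr.ne'
  have hL : (w 0 : ℂ) * z + w 1 ≠ 0 := linear_ne_zero_of_ne_zero hw z
  have hb : 0 ≤ e1Base w z := by
    unfold e1Base; positivity
  have h0 : (r • w) 0 = (r : ℤ) * w 0 := by simp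
  have h1 : (r • w) 1 = (r : ℤ) * w 1 := by simp
  unfold e1Term
  rw [e1Base_nsmul hr w z, h0, h1, ofReal_mul, mul_cpow_ofReal_nonneg (by positivity) hb,
    ofReal_inv_sq_cpow hr]
  push_cast
  rw [map_mul, show ((r : ℂ) * (w 0 : ℂ)) * (z : ℂ) + (r : ℂ) * (w 1 : ℂ) =
      (r : ℂ) * ((w 0 : ℂ) * z + w 1) by ring, mul_inv,
    show (-1 - 2 * s) = (-1 : ℂ) + (-2 * s) by ring, cpow_add _ _ hr0, cpow_neg_one]
  ring

/-- If `χ(r) ≠ 0` then `M ∣ r c ↔ M ∣ c`. [folklore] -/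
theorem dvd_mul_iff_of_apply_ne_zero {r : ℕ} (hr : χ r ≠ 0) (c : ℤ) :
    (M : ℤ) ∣ (r : ℤ) * c ↔ (M : ℤ) ∣ c := by
  refine ⟨fun h ↦ ?_, fun h ↦ dvd_mul_of_dvd_right h _⟩
  have hu : IsUnit ((r : ℕ) : ZMod M) := by
    by_contra hnu
    exact hr (χ.map_nonunit hnu)
  have hcop : Nat.Coprime r M := (ZMod.isUnit_iff_coprime r M).mp hu
  have hcop' : IsCoprime (M : ℤ) (r : ℤ) := by
    rw [Int.isCoprime_iff_gcd_eq_one, Int.gcd_natCast_natCast]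
    exact hcop.symm
  exact hcop'.dvd_of_dvd_mul_left h

/-- **Scaling for the restricted summand**: `gTerm(r • w) = χ(r) r^{-1-2s} gTerm(w)`. [folklore] -/
theorem gTerm_nsmul {r : ℕ} (hr : 0 < r) (s : ℂ) (w : Fin 2 → ℤ) (z : ℍ) :
    gTerm χ s (r • w) z = χ r * (r : ℂ) ^ (-1 - 2 * s) * gTerm χ s w z := by
  have h0w : (r • w) 0 = (r : ℤ) * w 0 := by simp
  unfold gTerm
  rw [h0w]
  rcases eq_or_ne (χ r) 0 with h0 | h0
  · rw [h0, zero_mul, zero_mul]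
    split_ifs with h
    · rw [e1Term_nsmul χ hr, h0, zero_mul, zero_mul]
    · rfl
  · by_cases h : (M : ℤ) ∣ w 0
    · rw [if_pos ((dvd_mul_iff_of_apply_ne_zero χ h0 _).mpr h), if_pos h, e1Term_nsmul χ hr]
    · rw [if_neg (fun h' ↦ h ((dvd_mul_iff_of_apply_ne_zero χ h0 _).mp h')), if_neg h, mul_zero]

/-! ### Absolute convergence over all pairs for `Re s > 1/2` -/

/-- The summand bound for every non-zero pair (as in `norm_e1Term_le_majorant`, which assumed the
pair coprime). [folklore] -/
theorem norm_e1Term_le_majorant' {v : Fin 2 → ℤ} (hv : v ≠ 0) {s : ℂ} (hs : -1 / 2 ≤ s.re) (z : ℍ) :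
    ‖e1Term χ s v z‖ ≤ z.im ^ s.re * (r z ^ (-(1 + 2 * s.re)) * ‖v‖ ^ (-(1 + 2 * s.re))) := by
  have hL : 0 < ‖(v 0 : ℂ) * z + v 1‖ := norm_pos_iff.mpr (linear_ne_zero_of_ne_zero hv z)
  have hb : 0 < e1Base v z := div_pos z.im_pos (pow_pos hL 2)
  have h1 : ‖e1Term χ s v z‖ ≤ ‖(v 0 : ℂ) * z + v 1‖⁻¹ * (e1Base v z) ^ s.re := by
    unfold e1Term
    rw [norm_mul, norm_mul, norm_inv, Complex.norm_cpow_eq_rpow_re_of_pos hb]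
    have hχ : ‖χ (v 1)‖ ≤ 1 := DirichletCharacter.norm_le_one χ _
    have h2 : 0 ≤ ‖(v 0 : ℂ) * z + v 1‖⁻¹ * e1Base v z ^ s.re :=
      mul_nonneg (inv_nonneg.mpr (norm_nonneg _)) (Real.rpow_nonneg hb.le _)
    calc ‖χ (v 1)‖ * ‖(v 0 : ℂ) * z + v 1‖⁻¹ * e1Base v z ^ s.re
        = ‖χ (v 1)‖ * (‖(v 0 : ℂ) * z + v 1‖⁻¹ * e1Base v z ^ s.re) := by ring
      _ ≤ 1 * (‖(v 0 : ℂ) * z + v 1‖⁻¹ * e1Base v z ^ s.re) := mul_le_mul_of_nonneg_right hχ h2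
      _ = _ := one_mul _
  refine h1.trans ?_
  have h3 : ‖(v 0 : ℂ) * z + v 1‖⁻¹ * (e1Base v z) ^ s.re =
      z.im ^ s.re * ‖(v 0 : ℂ) * z + v 1‖ ^ (-(1 + 2 * s.re)) := by
    have h2' : (‖(v 0 : ℂ) * z + v 1‖ ^ 2) ^ s.re = ‖(v 0 : ℂ) * z + v 1‖ ^ (2 * s.re) := by
      rw [← Real.rpow_natCast, ← Real.rpow_mul hL.le]; norm_num
    unfold e1Base
    rw [Real.div_rpow z.im_pos.le (by positivity), h2',
      show -(1 + 2 * s.re) = (-1) + (-(2 * s.re)) by ring, Real.rpow_add hL,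
      Real.rpow_neg hL.le (2 * s.re), Real.rpow_neg_one, div_eq_mul_inv]
    ring
  rw [h3]
  exact mul_le_mul_of_nonneg_left (summand_bound z (k := 1 + 2 * s.re) (by linarith) v)
    (by positivity)

/-- **Absolute convergence of `G(z, s)` for `Re s > 1/2`** (over `ℤ²`; the term at `0` is `0`).
[folklore] -/
theorem summable_gTerm {s : ℂ} (hs : 1 / 2 < s.re) (z : ℍ) :
    Summable fun v : Fin 2 → ℤ ↦ gTerm χ s v z := by
  have hmaj : Summable fun v : Fin 2 → ℤ ↦
      z.im ^ s.re * (r z ^ (-(1 + 2 * s.re)) * ‖v‖ ^ (-(1 + 2 * s.re))) :=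
    ((summable_one_div_norm_rpow (k := 1 + 2 * s.re) (by linarith)).mul_left _).mul_left _
  refine Summable.of_norm_bounded hmaj fun v ↦ ?_
  have hnn : ∀ v : Fin 2 → ℤ,
      0 ≤ z.im ^ s.re * (r z ^ (-(1 + 2 * s.re)) * ‖v‖ ^ (-(1 + 2 * s.re))) := fun v ↦
    mul_nonneg (Real.rpow_nonneg z.im_pos.le _)
      (mul_nonneg (Real.rpow_nonneg (r_pos z).le _) (Real.rpow_nonneg (norm_nonneg _) _))
  rcases eq_or_ne v 0 with rfl | hv
  · simp only [gTerm, e1Term_zero_vec, ite_self, norm_zero]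
    simpa using hnn 0
  · unfold gTerm
    split_ifs
    · exact norm_e1Term_le_majorant' χ hv (by linarith) z
    · rw [norm_zero]; exact hnn v

/-- The norms are summable too. [folklore] -/
theorem summable_norm_gTerm {s : ℂ} (hs : 1 / 2 < s.re) (z : ℍ) :
    Summable fun v : Fin 2 → ℤ ↦ ‖gTerm χ s v z‖ :=
  (summable_gTerm χ hs z).norm

/-! ### Over coprime pairs `gTerm` sums to `E₁,χ` -/

/-- The coprime pairs with `M ∣ c`, as a subtype of `gammaSet 1 1 0`-members. [folklore] -/
theorem tsum_gTerm_gammaSet_one_eq (s : ℂ) (z : ℍ) :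
    ∑' w : gammaSet 1 1 0, gTerm χ s w z = eisensteinOne χ z s := by
  unfold eisensteinOne gTerm
  -- `∑' over gammaSet110 of an indicator = ∑' over the sub-subtype`
  rw [tsum_subtype (gammaSet 1 1 0)
    (fun w : Fin 2 → ℤ ↦ if (M : ℤ) ∣ w 0 then e1Term χ s w z else 0)]
  have hind : (gammaSet 1 1 0).indicator
      (fun w : Fin 2 → ℤ ↦ if (M : ℤ) ∣ w 0 then e1Term χ s w z else 0) =
      {w : Fin 2 → ℤ | IsCoprime (w 0) (w 1) ∧ (M : ℤ) ∣ w 0}.indicator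
        (fun w ↦ e1Term χ s w z) := by
    funext w
    classical
    simp only [Set.indicator_apply, Set.mem_setOf_eq, mem_gammaSet_one]
    by_cases h1 : IsCoprime (w 0) (w 1) <;> by_cases h2 : (M : ℤ) ∣ w 0 <;> simp [h1, h2]
  rw [hind, ← tsum_subtype]
  exact (Equiv.refl _).tsum_eq (fun w : {w : Fin 2 → ℤ // IsCoprime (w 0) (w 1) ∧ (M : ℤ) ∣ w 0} ↦
    e1Term χ s (w : Fin 2 → ℤ) z)

/-! ### Sorting by the gcd: `G = L(χ, 1 + 2s) · E₁,χ` -/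

/-- On `gammaSet 1 b 0` (`b ≠ 0`) the summand is `χ(b) b^{-1-2s}` times the summand at the
coprime pair `v / b`. [folklore] -/
theorem gTerm_of_gammaSet (s : ℂ) (z : ℍ) {b : ℕ} (hb : b ≠ 0) (v : gammaSet 1 b 0) :
    gTerm χ s v z = χ b * (b : ℂ) ^ (-1 - 2 * s) * gTerm χ s (divIntMap b v.1) z := by
  have hv := gammaSet_eq_gcd_mul_divIntMap v.2
  conv_lhs => rw [hv]
  exact gTerm_nsmul χ (Nat.pos_of_ne_zero hb) s _ z

/-- **`G(z, s) = L(χ, 1 + 2s) · E₁,χ(z, s)` for `Re s > 1/2`** (sorting the pairs by their gcd;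
Hecke 1927, §1; Miyake §7.2). [folklore] -/
theorem eisensteinOneAll_eq_LFunction_mul [NeZero M] {s : ℂ} (hs : 1 / 2 < s.re) (z : ℍ) :
    eisensteinOneAll χ z s = χ.LFunction (1 + 2 * s) * eisensteinOne χ z s := by
  have h2s : 1 < (1 + 2 * s).re := by simp; linarith
  have hsum := summable_gTerm χ hs z
  -- the two factors as absolutely convergent series
  set T : ℕ → ℂ := fun b ↦ LSeries.term (fun n : ℕ ↦ χ n) (1 + 2 * s) b with hT
  have hLT : χ.LFunction (1 + 2 * s) = ∑' b : ℕ, T b := by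
    rw [DirichletCharacter.LFunction_eq_LSeries χ h2s]; rfl
  have hL : Summable fun b : ℕ ↦ ‖T b‖ :=
    (DirichletCharacter.LSeriesSummable_of_one_lt_re χ h2s).norm
  set g : (Fin 2 → ℤ) → ℂ := fun v ↦ gTerm χ s v z with hg
  have hE : Summable fun w : gammaSet 1 1 0 ↦ ‖g w‖ := (summable_norm_gTerm χ hs z).subtype _
  -- sort the left side by the gcd
  have hleft : eisensteinOneAll χ z s = ∑' b : ℕ, ∑' v : gammaSet 1 b 0, g v := by
    unfold eisensteinOneAll
    rw [← gammaSetDivGcdSigmaEquiv.symm.tsum_eq]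
    have hsumm : Summable fun v : Σ r : ℕ, gammaSet 1 r 0 ↦ g v.2 :=
      gammaSetDivGcdSigmaEquiv.symm.summable_iff.mpr hsum |>.congr <| by simp [hg]
    rw [← hsumm.tsum_sigma]
    rfl
  -- expand the right side as a double series
  have hright : χ.LFunction (1 + 2 * s) * eisensteinOne χ z s =
      ∑' b : ℕ, ∑' w : gammaSet 1 1 0, T b * g w := by
    rw [hLT, ← tsum_gTerm_gammaSet_one_eq χ s z, tsum_mul_tsum_of_summable_norm hL hE,
      Summable.tsum_prod' (summable_mul_of_summable_norm hL hE) fun b ↦ hE.of_norm.mul_left (T b)]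
  rw [hleft, hright]
  refine tsum_congr fun b ↦ ?_
  rcases eq_or_ne b 0 with rfl | hb
  · -- gcd 0: only v = 0, and `T 0 = 0`
    have h0 : ∀ v : gammaSet 1 0 0, g v = 0 := by
      intro v
      have hv : (v : Fin 2 → ℤ) = 0 := by
        have := (gammaSet_one_mem_iff (r := 0) v.1).mp v.2
        rw [Int.gcd_eq_zero_iff] at this
        ext i; fin_cases i <;> simp [this.1, this.2]
      simp [hg, gTerm, hv, e1Term_zero_vec]
    have hT0 : T 0 = 0 := by simp [hT]
    simp [tsum_congr h0, hT0]
  · haveI : NeZero b := ⟨hb⟩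
    have hterm : T b = χ b * (b : ℂ) ^ (-1 - 2 * s) := by
      simp only [hT]
      rw [LSeries.term_of_ne_zero hb, div_eq_mul_inv, ← cpow_neg]
      congr 2; ring
    rw [← (gammaSetDivGcdEquiv b).tsum_eq (fun w ↦ T b * g w)]
    refine tsum_congr fun v ↦ ?_
    rw [gammaSetDivGcdEquiv_eq, hterm]
    simp only [hg]
    rw [gTerm_of_gammaSet χ s z hb v, mul_assoc]

end Literature.NumberTheory.EllipticCurves.ModularForms
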